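import Summits.BirchSwinnertonDyer.BirchSwinnertonDyer.Theorems.ResidualThetaTransportAtTwoResidualSignedLambdaLowerCMAtTwoFourTermDuality
import Mathlib.CategoryTheory.CofilteredSystem
import Mathlib.CategoryTheory.Functor.OfSequence
import HarnessLib

/-!
# Glue for the RSL_g duality kit: transporting `hm` along the Coleman isomorphism, `Λ`- versus `𝒪`-quotients, and Kőnig's lemma
# for the deep half (the passage from finite layers to `𝐇¹ = lim←`)

Route `ResidualThetaTransportAtTwo` (RTT), crux RSL_g `ResidualSignedLambdaLowerCMAtTwo` (stmt-BirchSwinnertonDyer-22608; the (R≥)ᵖ crux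
stmt-BirchSwinnertonDyer-26074 is glue above it); memo `Cruxes/ResidualThetaCountLowerPureAtTwo/DUALITY-KIT-g16.md` §2 (stubs S2–S4). Seat
`prover-bsd-wall-rtt-p2` g16 (`--supports`, closes nothing). THEOREMS ONLY (no definition, no named fact, no instance, no `sorry`); pure algebra /
set theory; BSD is not proved by any of this; 22608 / 26074 OPEN.

* §1 **`finrank_baseChange_quotient_eq_of_map_eq`** — `λ(P/N) = λ(M'/I)` along an `A`-linear `e : P ≃ M'` with `e(N) = I|_A` (`I` a `Λ`-submodule);
  **`finrank_baseChange_quotient_restrictScalars_eq`**, `finite_baseChange_quotient_restrictScalars_iff` — `H ⧸ Z|_𝒪` versus `H ⧸ Z`;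
  **`map_restrictScalars_span_singleton`**, **`finrank_baseChange_quotient_map_locd_span_eq`** — with `Z = Λ·z`, `locd` and the Coleman isomorphism
  `col : P ≃ₗ[Λ] Λ` `Λ`-linear: `λ(P / locd(Z)) = λ(Λ/(col (locd z)))`, the shape in which `hm : d + e ≤ λ(P/locd Z)` of
  `le_finrank_baseChange_characterModule_of_duality` is read off `col (locd z) = C c·D·Lm` (`add_le_finrank_baseChange_quotient_span_of_eq_C_mul_mul`).
* §2 **`exists_compatible_preimage`** (B3, adapted from the crux sketch `Sketch_sidea_k1_g4.lean` §B, kernel-checked there but not importable) —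
  along towers of FINITE stages, a compatible family with a preimage at every stage has a compatible family of preimages (Kőnig,
  `nonempty_sections_of_finite_inverse_system`); the tool by which the deep half (DH) passes from the finite-level Poitou–Tate theorem to `𝐇¹ = lim←_n`.

References: [Washington1997] §13.2; [Kobayashi2003] Thm. 7.3; [MilneADT2006] Ch. I Thm. 4.10; [Rubin2000] App. B §B.3.
-/

set_option autoImplicit false
-- the Theorems namespace of this sub repeats the summit name by design (D-0017 nested layout)
set_option linter.dupNamespace false

noncomputable section

open scoped TensorProduct Classical

namespace Summit.BirchSwinnertonDyer.BirchSwinnertonDyer.Theorems.CharIdealLambda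

universe u u' v w

/-! ## §1 Transport of λ along linear equivalences of quotients; `Λ`- versus `𝒪`-quotients -/

section Transport

variable {A : Type u} [CommRing A] (K : Type w) [CommRing K] [Algebra A K]
  {Λ : Type u'} [Ring Λ] [Algebra A Λ]
  {P : Type v} [AddCommGroup P] [Module A P]
  {M' : Type v} [AddCommGroup M'] [Module Λ M'] [Module A M'] [IsScalarTower A Λ M']

/-- **`λ(P/N) = λ(M'/I)` along an `A`-linear equivalence `e : P ≃ M'` carrying `N` onto `I|_A`** (`I` a `Λ`-submodule of `M'`, read as an
`A`-module through the scalar tower). [folklore] -/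
theorem finrank_baseChange_quotient_eq_of_map_eq (e : P ≃ₗ[A] M') (N : Submodule A P) (I : Submodule Λ M')
    (h : N.map (e : P →ₗ[A] M') = I.restrictScalars A) :
    Module.finrank K (K ⊗[A] (P ⧸ N)) = Module.finrank K (K ⊗[A] (M' ⧸ I)) :=
  (((Submodule.Quotient.equiv N (I.restrictScalars A) e h).trans
    (Submodule.Quotient.restrictScalarsEquiv A I)).baseChange A K _ _).finrank_eq

/-- `Module.Finite K (K ⊗ (P/N)) ↔ Module.Finite K (K ⊗ (M'/I))` in the same situation. [folklore] -/
theorem finite_baseChange_quotient_iff_of_map_eq (e : P ≃ₗ[A] M') (N : Submodule A P) (I : Submodule Λ M')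
    (h : N.map (e : P →ₗ[A] M') = I.restrictScalars A) :
    Module.Finite K (K ⊗[A] (P ⧸ N)) ↔ Module.Finite K (K ⊗[A] (M' ⧸ I)) :=
  let f := ((Submodule.Quotient.equiv N (I.restrictScalars A) e h).trans
    (Submodule.Quotient.restrictScalarsEquiv A I)).baseChange A K _ _
  ⟨fun _ ↦ Module.Finite.equiv f, fun _ ↦ Module.Finite.equiv f.symm⟩

/-- **`H ⧸ Z|_𝒪` and `H ⧸ Z` have the same λ** for a `Λ`-submodule `Z` (e.g. `Z = P.Z` of Kato's package versus the `𝒪`-submodule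
`Z|_𝒪` fed to `le_finrank_baseChange_characterModule_of_duality`). [folklore] -/
theorem finrank_baseChange_quotient_restrictScalars_eq (Z : Submodule Λ M') :
    Module.finrank K (K ⊗[A] (M' ⧸ Z.restrictScalars A)) = Module.finrank K (K ⊗[A] (M' ⧸ Z)) :=
  ((Submodule.Quotient.restrictScalarsEquiv A Z).baseChange A K _ _).finrank_eq

/-- `Module.Finite K (K ⊗ (H ⧸ Z|_𝒪)) ↔ Module.Finite K (K ⊗ (H ⧸ Z))`. [folklore] -/
theorem finite_baseChange_quotient_restrictScalars_iff (Z : Submodule Λ M') :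
    Module.Finite K (K ⊗[A] (M' ⧸ Z.restrictScalars A)) ↔ Module.Finite K (K ⊗[A] (M' ⧸ Z)) :=
  let f := (Submodule.Quotient.restrictScalarsEquiv A Z).baseChange A K _ _
  ⟨fun _ ↦ Module.Finite.equiv f, fun _ ↦ Module.Finite.equiv f.symm⟩

variable {H : Type v} [AddCommGroup H] [Module Λ H] [Module A H] [IsScalarTower A Λ H]
  {PΛ : Type v} [AddCommGroup PΛ] [Module Λ PΛ] [Module A PΛ] [IsScalarTower A Λ PΛ]

/-- **`locd(Λ·z)|_𝒪 = (Λ·locd z)|_𝒪`**: the image of the zeta span under a `Λ`-linear localisation, read over `𝒪`. [folklore] -/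
theorem map_restrictScalars_span_singleton (locd : H →ₗ[Λ] PΛ) (z : H) :
    ((Submodule.span Λ {z}).restrictScalars A).map (locd.restrictScalars A) =
      (Submodule.span Λ {locd z}).restrictScalars A := by
  ext x
  simp only [Submodule.mem_map, Submodule.restrictScalars_mem, Submodule.mem_span_singleton, LinearMap.coe_restrictScalars]
  constructor
  · rintro ⟨y, ⟨a, rfl⟩, rfl⟩
    exact ⟨a, by rw [map_smul]⟩
  · rintro ⟨a, rfl⟩
    exact ⟨a • z, ⟨a, rfl⟩, by rw [map_smul]⟩

/-- **Transport of `hm` along the Coleman isomorphism**: for `Λ`-linear `locd : H → P` and `col : P ≃ Λm` (`Λm` any `Λ`-module, in the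
application `Λ` itself), `λ(P / locd(Λ·z)) = λ(Λm / Λ·col(locd z))`; with `Λm = Λ_𝒪 = 𝒪⟦T⟧` the right side is `λ(Λ_𝒪/(col (locd z)))`, computed by
`add_le_finrank_baseChange_quotient_span_of_eq_C_mul_mul` from `col (locd z) = C c·D·Lm`. [cite: Kobayashi2003, Thm. 7.3 ((7.21), p. 13)] -/
theorem finrank_baseChange_quotient_map_locd_span_eq {Λm : Type v} [AddCommGroup Λm] [Module Λ Λm] [Module A Λm]
    [IsScalarTower A Λ Λm] (locd : H →ₗ[Λ] PΛ) (col : PΛ ≃ₗ[Λ] Λm) (z : H) :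
    Module.finrank K (K ⊗[A] (PΛ ⧸ ((Submodule.span Λ {z}).restrictScalars A).map (locd.restrictScalars A))) =
      Module.finrank K (K ⊗[A] (Λm ⧸ Submodule.span Λ {col (locd z)})) := by
  refine finrank_baseChange_quotient_eq_of_map_eq K (col.restrictScalars A) _ _ ?_
  rw [map_restrictScalars_span_singleton]
  have := map_restrictScalars_span_singleton (A := A) (col : PΛ →ₗ[Λ] Λm) (locd z)
  simpa using this

end Transport

/-! ## §2 Kőnig: the existence half passes from the finite stages to the inverse limit (B3) -/

section Koenig

-- adapted from Cruxes/ResidualThetaCountLowerPureAtTwo/Sketch_sidea_k1_g4.lean §B (stub-ideation k1 g4), B3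

/-- **The existence half passes to the Iwasawa limit by Kőnig alone** (B3). Along towers of FINITE stages `H n` and arbitrary stages `P n`
with transitions `tH`, `tP` and commuting maps `loc n : H n → P n`: if a compatible family `y ∈ ∏ P n` has a preimage under `loc n` at
every stage, it has a COMPATIBLE family of preimages (`nonempty_sections_of_finite_inverse_system` on the nonempty finite fibres).
In the application `H n = H¹(ℚ_Σ/ℚ_n, T/ϖ^{k(n)})`, `P n` = the local plus-quotient at the same stage, `loc n` the localisation; no `lim¹`,
no Mittag-Leffler, no injectivity is needed. [cite: Rubin2000, App. B §B.3 (Prop. B.2.3)] [cite: MilneADT2006, Ch. I, Thm. 4.10 (b)] -/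
theorem exists_compatible_preimage {H P : ℕ → Type} [∀ n, Finite (H n)]
    (tH : ∀ n, H (n + 1) → H n) (tP : ∀ n, P (n + 1) → P n) (loc : ∀ n, H n → P n)
    (hcomm : ∀ n x, loc n (tH n x) = tP n (loc (n + 1) x))
    (y : ∀ n, P n) (hy : ∀ n, tP n (y (n + 1)) = y n)
    (hfib : ∀ n, ∃ x : H n, loc n x = y n) :
    ∃ x : ∀ n, H n, (∀ n, tH n (x (n + 1)) = x n) ∧ ∀ n, loc n (x n) = y n := by
  classical
  let F : ℕ → Type := fun n ↦ {x : H n // loc n x = y n}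
  let tF : ∀ n, F (n + 1) ⟶ F n := fun n ↦
    TypeCat.ofHom (fun x : F (n + 1) ↦ (⟨tH n x.1, by rw [hcomm, x.2, hy]⟩ : F n))
  let G : CategoryTheory.Functor ℕᵒᵖ Type := CategoryTheory.Functor.ofOpSequence (X := F) tF
  haveI : ∀ j : ℕᵒᵖ, Finite (G.obj j) := fun j ↦ by
    change Finite (F j.unop)
    infer_instance
  haveI : ∀ j : ℕᵒᵖ, Nonempty (G.obj j) := fun j ↦ by
    change Nonempty (F j.unop)
    obtain ⟨x, hx⟩ := hfib j.unop
    exact ⟨⟨x, hx⟩⟩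
  obtain ⟨s, hs⟩ := nonempty_sections_of_finite_inverse_system G
  refine ⟨fun n ↦ (s (Opposite.op n) : F n).1, fun n ↦ ?_, fun n ↦ (s (Opposite.op n) : F n).2⟩
  have hmap : G.map (CategoryTheory.homOfLE (Nat.le_add_right n 1)).op = tF n :=
    CategoryTheory.Functor.ofOpSequence_map_homOfLE_succ tF n
  have := hs (CategoryTheory.homOfLE (Nat.le_add_right n 1)).op
  rw [hmap] at this
  have h2 : ((CategoryTheory.ConcreteCategory.hom (tF n)) (s (Opposite.op (n + 1)))).1 =
      tH n (s (Opposite.op (n + 1))).1 := rfl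
  rw [← h2]
  exact congrArg Subtype.val this

/-- **Kőnig with a uniform torsion fudge**: if at every finite stage the preimage exists only after multiplication by a fixed scalar
(`loc n x = a • y n`), then the compatible family `(a • y n)_n` has a compatible family of preimages — the shape in which TP2's
`stub_poitouTateDeepTwo` (`2^m · z = pair(x)`) feeds (DH) of `le_finrank_baseChange_characterModule_of_duality`. [cite: Rubin2000, App. B §B.3] -/
theorem exists_compatible_preimage_smul {H P : ℕ → Type} [∀ n, Finite (H n)] {R : Type} [∀ n, SMul R (P n)]
    (tH : ∀ n, H (n + 1) → H n) (tP : ∀ n, P (n + 1) → P n) (loc : ∀ n, H n → P n)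
    (hcomm : ∀ n x, loc n (tH n x) = tP n (loc (n + 1) x))
    (htP : ∀ n (r : R) (q : P (n + 1)), tP n (r • q) = r • tP n q)
    (y : ∀ n, P n) (hy : ∀ n, tP n (y (n + 1)) = y n) (a : R)
    (hfib : ∀ n, ∃ x : H n, loc n x = a • y n) :
    ∃ x : ∀ n, H n, (∀ n, tH n (x (n + 1)) = x n) ∧ ∀ n, loc n (x n) = a • y n :=
  exists_compatible_preimage tH tP loc hcomm (fun n ↦ a • y n) (fun n ↦ by rw [htP, hy]) hfib

end Koenig

end Summit.BirchSwinnertonDyer.BirchSwinnertonDyer.Theorems.CharIdealLambda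

end
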